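import Summits.QuantumAdvantage.QuantumAdvantage.Theorems.CubicForrelationNearExactIsExactCubicFormR2Frame
import Summits.QuantumAdvantage.QuantumAdvantage.Theorems.CubicForrelationNearExactIsExactCubicFormTensor
import Summits.QuantumAdvantage.QuantumAdvantage.Theorems.CubicForrelationNearExactIsExactTwelvePartnerSymplectic

/-!
# Crux `CubicForrelation.NearExactIsExact` (stmt-QuantumAdvantage-14043) — E1280-even: TRANSPORT of the partner package under an affine change
  of frame

Certificate seat `b2b-cforr-cert` (gen 42).  HONEST FRAMING: kernel-checked bookkeeping (standard axioms), one reusable lemma for the branch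
files of `HR2` / `HR4` (…TwelvePartnerLight): every "WLOG" of R2-PARTNER.md / R4-PARTNER.md (the `S₃`-symmetry of the three cells, the
`S`-coordinates in which the light cell's cubic form is `s₀∧ω_{2h}` or `T ⊕ T′`, the symplectic frame of R4) is an invertible affine map
`y ↦ b ⊕ P y`, and this lemma carries the whole package (cubic `κ`, its cubic form `d`, a symmetric pairing partner `c`, `(PAIR)`) through
such a map.  Nothing about `θ₁₂`; NOT summit progress.

`tpw_partner_transport`: given `κ` cubic on `n` bits, `d` its cubic form at unit vectors (symmetric, zero diagonals), `c` a symmetric pairing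
partner, and `P, Pi` mutually inverse with a translation `b`, there are `κ', c', d'` with the DEFINING EQUATIONS `κ' y = κ(b ⊕ P y)`,
`c'_{pjk} = Σ Pi_{pq} Pi_{jα} Pi_{kβ} c_{qαβ}`, `d'_{φjk} = Σ P_{ψφ} P_{αj} P_{βk} d_{ψαβ}` and the PROPERTIES: `κ'` cubic (`tct_comp_isDegLeFun`),
`wt κ' = wt κ` (`tct_card_comp_eq`), `c'` symmetric with zero diagonals (`tcx_transport_hyps`), `d'` is the cubic form of `κ'`
(`tct_third_comp_coord`), and `(PAIR)` for `(c', d')` (`tps_pair_covariant`).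

References: this seat lineage (g37 R2-PARTNER §1 invariance, g39 HANDPROOFS §3 (L4), g40 transport tools).  Axioms: the standard three.
-/

set_option linter.dupNamespace false -- D-0017: single-problem summit ⇒ `QuantumAdvantage.QuantumAdvantage` by design

namespace Summit.QuantumAdvantage.QuantumAdvantage.Theorems.CubicForrelation.NearExactIsExact

open Finset
open Literature.Computability.QuantumComplexity
open Literature.Computability.QuantumComplexity.BuzetChailloux (bxor zeroVec bxor_comm bxor_self bxor_zeroVec zeroVec_bxor
  bxor_bxor_cancel_left)

variable {n : ℕ}

/-- **Transport of the partner package under an invertible affine map `y ↦ b ⊕ P y`.**  See the module docstring.  The three defining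
equations come first (so that callers keep SHORT names `κ', c', d'`), then: `κ'` cubic, `wt κ' = wt κ`, `c'` symmetric in both index pairs with
zero diagonals, `d'` = the cubic form of `κ'` at unit vectors, `(PAIR)` for `(c', d')`. [this work] -/
theorem tpw_partner_transport (κ : (Fin n → Bool) → Bool) (hκ : IsDegLeFun 3 κ)
    (c d : Fin n → Fin n → Fin n → ZMod 2)
    (hcs : ∀ p j k, c p k j = c p j k) (hcc : ∀ p j k, c j p k = c p j k) (hcd : ∀ p j, c p j j = 0)
    (hds : ∀ φ j k, d φ k j = d φ j k) (hdd : ∀ φ j, d φ j j = 0)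
    (hd : ∀ φ j k, d φ j k =
      if ((((κ zeroVec ^^ κ (bxor zeroVec (fun l => decide (l = k)))) ^^
            (κ (bxor zeroVec (fun l => decide (l = j))) ^^ κ (bxor (bxor zeroVec (fun l => decide (l = j))) (fun l => decide (l = k))))) ^^
          ((κ (bxor zeroVec (fun l => decide (l = φ))) ^^ κ (bxor (bxor zeroVec (fun l => decide (l = φ))) (fun l => decide (l = k)))) ^^
            (κ (bxor (bxor zeroVec (fun l => decide (l = φ))) (fun l => decide (l = j))) ^^
              κ (bxor (bxor (bxor zeroVec (fun l => decide (l = φ))) (fun l => decide (l = j))) (fun l => decide (l = k))))))) = true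
      then 1 else 0)
    (hpair : ∀ p φ, (∑ j, ∑ k, (if j < k then c p j k * d φ j k else 0)) = if p = φ then 1 else 0)
    (P Pi : Fin n → Fin n → ZMod 2)
    (hPPi : ∀ ψ ω, (∑ φ, P ψ φ * Pi φ ω) = if ψ = ω then 1 else 0)
    (hPiP : ∀ ψ ω, (∑ φ, Pi ψ φ * P φ ω) = if ψ = ω then 1 else 0) (b : Fin n → Bool) :
    ∃ (κ' : (Fin n → Bool) → Bool) (c' d' : Fin n → Fin n → Fin n → ZMod 2),
      (∀ y, κ' y = κ (bxor b (fun ψ => decide ((∑ φ, P ψ φ * (if y φ = true then (1 : ZMod 2) else 0)) = 1)))) ∧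
      (∀ p j k, c' p j k = ∑ q, ∑ α, ∑ β, Pi p q * Pi j α * Pi k β * c q α β) ∧
      (∀ φ j k, d' φ j k = ∑ ψ, ∑ α, ∑ β, P ψ φ * P α j * P β k * d ψ α β) ∧
      IsDegLeFun 3 κ' ∧
      #(univ.filter fun y : Fin n → Bool => κ' y = true) = #(univ.filter fun x : Fin n → Bool => κ x = true) ∧
      (∀ p j k, c' p k j = c' p j k) ∧ (∀ p j k, c' j p k = c' p j k) ∧ (∀ p j, c' p j j = 0) ∧
      (∀ φ j k, d' φ j k =
        if ((((κ' zeroVec ^^ κ' (bxor zeroVec (fun l => decide (l = k)))) ^^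
                (κ' (bxor zeroVec (fun l => decide (l = j))) ^^ κ' (bxor (bxor zeroVec (fun l => decide (l = j))) (fun l => decide (l = k))))) ^^
              ((κ' (bxor zeroVec (fun l => decide (l = φ))) ^^ κ' (bxor (bxor zeroVec (fun l => decide (l = φ))) (fun l => decide (l = k)))) ^^
                (κ' (bxor (bxor zeroVec (fun l => decide (l = φ))) (fun l => decide (l = j))) ^^
                  κ' (bxor (bxor (bxor zeroVec (fun l => decide (l = φ))) (fun l => decide (l = j))) (fun l => decide (l = k))))))) = true
        then 1 else 0) ∧
      (∀ p φ, (∑ j, ∑ k, (if j < k then c' p j k * d' φ j k else 0)) = if p = φ then 1 else 0) := by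
  obtain ⟨κ', hfun⟩ : ∃ κ' : (Fin n → Bool) → Bool,
      κ' = fun y => κ (bxor b (fun ψ => decide ((∑ φ, P ψ φ * (if y φ = true then (1 : ZMod 2) else 0)) = 1))) := ⟨_, rfl⟩
  obtain ⟨d', hd'⟩ : ∃ d' : Fin n → Fin n → Fin n → ZMod 2,
      ∀ φ j k, d' φ j k = ∑ ψ, ∑ α, ∑ β, P ψ φ * P α j * P β k * d ψ α β := ⟨_, fun _ _ _ => rfl⟩
  obtain ⟨c', hc'⟩ : ∃ c' : Fin n → Fin n → Fin n → ZMod 2,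
      ∀ p j k, c' p j k = ∑ q, ∑ α, ∑ β, Pi p q * Pi j α * Pi k β * c q α β := ⟨_, fun _ _ _ => rfl⟩
  refine ⟨κ', c', d', fun y => by rw [hfun], hc', hd', ?_, ?_, ?_, ?_, ?_, ?_, ?_⟩
  · rw [hfun]; exact tct_comp_isDegLeFun κ hκ P b
  · rw [hfun]; exact tct_card_comp_eq P Pi κ hPPi hPiP b
  · intro p j k; rw [hc', hc']; exact (tcx_transport_hyps c Pi hcs hcc hcd).1 p j k
  · intro p j k; rw [hc', hc']; exact (tcx_transport_hyps c Pi hcs hcc hcd).2.1 p j k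
  · intro p j; rw [hc']; exact (tcx_transport_hyps c Pi hcs hcc hcd).2.2 p j
  · intro φ j k
    have h := tct_third_comp_coord κ P b hκ φ j k zeroVec zeroVec
    dsimp only at h
    rw [hfun]
    dsimp only
    rw [h, hd']
    exact Finset.sum_congr rfl fun ψ _ => Finset.sum_congr rfl fun α _ => Finset.sum_congr rfl fun β _ => by rw [hd ψ α β]
  · intro p φ
    have h := tps_pair_covariant c d hcs hcd hds hdd hpair (Matrix.of fun ψ φ => P ψ φ) (Matrix.of fun ψ φ => Pi ψ φ)
      (tcr2_matrix_inv P Pi hPiP) p φ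
    simp only [Matrix.of_apply] at h
    rw [← h]
    exact Finset.sum_congr rfl fun j _ => Finset.sum_congr rfl fun k _ => by rw [hc', hd']

end Summit.QuantumAdvantage.QuantumAdvantage.Theorems.CubicForrelation.NearExactIsExact
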